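/-
Copyright: lit-balaban Phase-2 proof seat p30 (gen 27).  Statement-level skeleton of a published paper; no proof claims beyond what
the kernel checks below.
-/
import Literature.MathematicalPhysics.QuantumFieldTheory.BalabanImbrieJaffe1984to88.BIJ85ScalarPropagatorDecay
import Literature.MathematicalPhysics.QuantumFieldTheory.BalabanImbrieJaffe1984to88.BIJ85TorusTentCutoff

/-!
# [BalabanImbrieJaffe1985] §7.3 p. 326 ⟵ [Balaban1983RegularityDecay] Theorem p. 573, (1.10)–(1.12): THE `ℓ²` ENGINE OF THE `δG_k` MEMBER AT
# SMALL NON-FLAT FIELDS — IMS / CACCIOPPOLI / AGMON BOUNDS FOR FUNCTIONS HARMONIC FOR `T = D_u^*D_u + aQ_k(u)^*Q_k(u)` ON PART OF THE TORUS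
# (kernel file 1 of 3 of the `δG_k(□, Ω)` value member; siblings: the local mean-value inequality and the (1.11)–(1.12) assembly)

T. Bałaban, J. Imbrie, A. Jaffe, *Renormalization of the Higgs model: minimizers, propagators and the stability of mean field theory*,
Commun. Math. Phys. **97** (1985) 299–329 [BalabanImbrieJaffe1985], row **C1.Eq7.3.1-7.3.2** (owner r15) / front **C2S14 (β′)** (owner r18:
the `δG` VALUE member (H1.12″) of `BIJ88DeltaLocClose235General.opClose231_gen` at small non-flat `U(1)` fields); the cited reference
[7] = T. Bałaban, *Regularity and decay of lattice Green's functions*, Commun. Math. Phys. **89** (1983) 571–597 [Balaban1983RegularityDecay].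

statement-level skeleton of published theorems with citation tags; proofs where landed; nothing here is a claim about the Yang–Mills mass gap

PDFs held and re-read this session: `paper:balaban1985-cmp97-bij-higgs-minimizers` p. 326 = PDF 28, lines 18–22: *"These inequalities can
be proved by an extension of the proofs of [7]. The propagators arising from Δ_k(u_k), under the restriction (7.3.1) on the gauge field, also
satisfy the regularity and decay estimates of [7]."*; `paper:balaban1983-cmp89-regularity-decay` p. 573 = PDF 3, the Theorem ("Proposition
2.1 of [1]"): *"(1.10) |(G_k(Ω,A)f)(x)| ≤ c₀exp(−δ₀dist(x, supp f))‖f‖_∞ for x ∈ Ω, dist(x, Ω^c) ≥ R₀.  If Ω ⊂ Ω₀, then for δG_k(Ω,Ω₀,A)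
defined by the equality δG_k(Ω,Ω₀,A) = G_k(Ω,A) − G_k(Ω₀,A), (1.11) we have the inequalities … (with the same restrictions on x, x′) with
the additional factor (1.12) on the right hand sides"* (the factor (1.12), `exp(−δ₀dist(x, Ω^c))exp(−δ₀dist(supp f, Ω^c))`, is the shape
(H1.12″) of the tree).

WHAT THIS FILE PROVES (every `U(1)` field `u` on the `j`-torus of record, `T = D_u^*D_u + aQ_k(u)^*Q_k(u)` = p30/p11's
`BIJ85ScalarForm464.opT (Dlin c U) (QlinK U k) a` on `FineSp P j`, real site weights `ω` acting by p33's `BIJ85AgmonDefect.wmul`):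
* §1 **`defect_D_le_add`**, **`defect_Q_le_add`** — the two IMS conjugation defects in ADDITIVE form,
  `‖D_u(ωφ)‖² − Re⟨D_uφ, D_u(ω²φ)⟩ ≤ c²Σ_b(ω(b₊) − ω(b₋))²‖φ(b₊)‖‖φ(b₋)‖` and
  `‖Q_k(u)(ωφ)‖² − Re⟨Q_k(u)φ, Q_k(u)(ω²φ)⟩ ≤ ½N⁻²Σ_yΣ_{x,x′∈B^k(y)}(ω(x) − ω(x′))²‖φ(x)‖‖φ(x′)‖` (`N = L^{kd}`) — valid for weights that
  VANISH somewhere (cutoffs), which p33's multiplicative defects `defect_D_le` / `defect_Q_le` (oscillation `≤ S·ω ω′`) do not allow;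
* §2 **`energy_wmul_le_of_harmonic`** (`a ≥ 0`): if `(Tφ)(x) = 0` wherever `ω(x) ≠ 0` then `‖D_u(ωφ)‖² + a‖Q_k(u)(ωφ)‖² ≤` the two defect
  sums (IMS localisation, `Re⟨ω²φ, Tφ⟩ = 0`); **`coercive_wmul_le_of_harmonic`** (`a > 0`, `j + k ≤ m + K`, block-scale plaquette smallness
  `2d³(L^{2k}θ)² ≤ 1`, p33's `coercive_opT`): `m₀‖ωφ‖² ≤` the two defect sums, `m₀ = min(a/2, c²N/(4n²))/N`, `n = L^k`;
* §4 **`caccioppoli`** (`a ≥ 0`, `ρ ≥ 1`): `T`-harmonic on the sup-ball `|x − y₀|_∞ ≤ 2ρ` ⟹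
  `c²Σ_{|z−y₀|_∞≤ρ−1}Σ_μ‖u_{zμ}φ(z+e_μ) − φ(z)‖² ≤ ρ⁻²(dc² + (a/2)N⁻¹n²)Σ_{|x−y₀|_∞≤2ρ+L^k}‖φ(x)‖²` (the radial tent of gen-26
  `BIJ85TorusTentCutoff.tentN` as weight);
* §5 **`agmon_harmonic`** (`a > 0`): for a `1/ℓ`-Lipschitz cutoff `η`, a `t/L^k`-Lipschitz tilt `g`, a set `S` carrying the block-scale
  oscillation of `η`, `φ` `T`-harmonic off `{η = 0}` and the tilt condition `(2dc²(t/L^k)² + aN⁻¹t²)e^{2t} ≤ m₀/2`: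
  `(m₀/2)Σ_x(η(x)e^{g(x)})²‖φ(x)‖² ≤ e^{2t}ℓ⁻²(2dc² + aN⁻¹n²)Σ_{x∈S}e^{2g(x)}‖φ(x)‖²` — the exponentially weighted `ℓ²` mass of a locally
  harmonic function is controlled by its weighted mass on the transition layer of the cutoff.
With the constants of record (`c = n = L^k` the inverse `k`-lattice spacing, `a = a_kN`) every constant above is a function of `(d, a_k, t, ρ/L^k,
ℓ/L^k)` alone — uniform in `k`, which is the point.  §3 is bookkeeping (tent Lipschitz bounds, block diameters, sums over blocks/shifts).

HOW IT IS USED (siblings, this seat): for k-block unions `□ ⊆ Ω` and `f` supported in `□`, `v = G_k(□)f − G_k(Ω)f` is `T`-harmonic on the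
rows of `□` at depth `≥ 2` from `T ∖ □` (p31 `nOp_mul_gBox`, p34 `nOp_univ_mulVec_apply_eq_of_interior`, bridge p27
`BIJ88NeumannPropagatorWholeTorus.opT_eq_nLin`); `agmon_harmonic` with `η` a cutoff of the collar of `□` and `g = −t|x₀ − ·|_∞/L^k` bounds the
tilted `ℓ²` mass of `v` near a deep row `x₀` by the (H1.10″) sup members of `G_k(□)`, `G_k(Ω)` on the collar; the local mean-value inequality
(sibling file 2, which uses `caccioppoli`) turns it into the pointwise (1.11)–(1.12) bound (sibling file 3).

HONEST SCOPE.  DIVERGENCE OF METHOD, disclosed: the print proves (1.10)–(1.12) by the generalized random walk expansion of [7] §2 after a local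
change of gauge (p. 326); this file is the finite-dimensional energy method instead (IMS localisation with weight `ηe^{g}` — Agmon's method —
and Caccioppoli's inequality), for the torus operator of record and with our own explicit constants; it is a kernel tool, it states no
estimate of the print by itself, and it claims no Hölder/derivative REGULARITY member.  Kernel lemmas tagged [folklore] are finite sums and
real-exponential algebra.  Nothing here is summit progress.  Unit `lit-balaban-p30` (literature-prover-lit-balaban-p30-g27-0), HOME
`run/shared/lean/pub/lit-balaban/`, 2026-08-23.
-/

open scoped RealInnerProductSpace BigOperators ComplexConjugate
open Finset

namespace Literature.MathematicalPhysics.QuantumFieldTheory.BalabanImbrieJaffe1984to88.BIJ85SmallFieldHarmonicAgmon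

open Literature.MathematicalPhysics.QuantumFieldTheory.Balaban1983to89
open BIJ88Sect3Statements (U1 toC toC_one toC_mul norm_toC cfg covD)
open BIJ85Sect1Model (HiggsField)
open BIJ85BlockAveragesTorus BIJ85BlockAveragesTorusK BIJ85ScalarPropagatorTorus BIJ85ScalarPropagatorTorusK
open BIJ85ScalarForm464 (opT inner_opT)
open BIJ85BlockAveragingIneq (sum_bond_eq sum_sum_dir sum_sum_shift_dir)
open BIJ85AbelianStokes (plaqC)
open BIJ85AgmonDefect (wmul wmul_apply wmul_wmul norm_wmul_sq inner_eq_re_sum sq_exp_sub_exp_le_of_abs_le)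
open BIJ85ScalarPropagatorDecay (coercive_opT inner_opT_left)
open LatticeFieldCalculus (supDist)
open BIJ85TorusTentCutoff (tentN tentN_nonneg tentN_le_one tentN_of_le tentN_of_ge abs_tentN_succ_sub_le ball mem_ball)
open BIJ85Ineq722Torus (supDist_triangle)
open B3TorusRadialSums (supDist_comm supDist_eq_zero_iff)

noncomputable section

variable {P : Params} {j : ℕ}

/-! ## §1 The two conjugation defects in ADDITIVE form (weights may vanish) -/

/-- kernel: `‖z‖² = Re(z̄z)`. [folklore] -/
private theorem norm_sq_eq_re (z : ℂ) : ‖z‖ ^ 2 = (conj z * z).re := by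
  rw [Complex.conj_mul']; norm_cast

/-- kernel: `Re(āb) = Re(b̄a)`. [folklore] -/
private theorem re_conj_mul_comm (a b : ℂ) : (conj a * b).re = (conj b * a).re := by
  rw [← Complex.conj_re (conj b * a), map_mul, Complex.conj_conj, mul_comm]

/-- kernel: **the one-bond defect identity** — for `A, B ∈ ℂ` and real `p, q`:
`‖pA − qB‖² − Re(conj(A − B)(p²A − q²B)) = (p − q)²·Re(ĀB)`. [folklore] -/
private theorem bond_defect_identity (A B : ℂ) (p q : ℝ) :
    ‖(p : ℂ) * A - (q : ℂ) * B‖ ^ 2 - (conj (A - B) * ((p : ℂ) ^ 2 * A - (q : ℂ) ^ 2 * B)).re = (p - q) ^ 2 * (conj A * B).re := by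
  rw [norm_sq_eq_re]
  simp only [map_sub, map_mul, Complex.conj_ofReal]
  have e1 : (conj A * B).re = (conj B * A).re := re_conj_mul_comm A B
  have hA : (conj A * A).re = ‖A‖ ^ 2 := (norm_sq_eq_re A).symm
  have hB : (conj B * B).re = ‖B‖ ^ 2 := (norm_sq_eq_re B).symm
  have expand1 : (((p : ℂ) * conj A - (q : ℂ) * conj B) * ((p : ℂ) * A - (q : ℂ) * B)).re =
      p ^ 2 * (conj A * A).re + q ^ 2 * (conj B * B).re - p * q * (conj A * B).re - p * q * (conj B * A).re := by
    have : ((p : ℂ) * conj A - (q : ℂ) * conj B) * ((p : ℂ) * A - (q : ℂ) * B) =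
        (p ^ 2 : ℝ) * (conj A * A) + (q ^ 2 : ℝ) * (conj B * B) - (p * q : ℝ) * (conj A * B) - (p * q : ℝ) * (conj B * A) := by
      push_cast; ring
    rw [this]
    simp only [Complex.sub_re, Complex.add_re, Complex.re_ofReal_mul]
  have expand2 : ((conj A - conj B) * ((p : ℂ) ^ 2 * A - (q : ℂ) ^ 2 * B)).re =
      p ^ 2 * (conj A * A).re + q ^ 2 * (conj B * B).re - q ^ 2 * (conj A * B).re - p ^ 2 * (conj B * A).re := by
    have : (conj A - conj B) * ((p : ℂ) ^ 2 * A - (q : ℂ) ^ 2 * B) =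
        (p ^ 2 : ℝ) * (conj A * A) + (q ^ 2 : ℝ) * (conj B * B) - (q ^ 2 : ℝ) * (conj A * B) - (p ^ 2 : ℝ) * (conj B * A) := by
      push_cast; ring
    rw [this]
    simp only [Complex.sub_re, Complex.add_re, Complex.re_ofReal_mul]
  rw [expand1, expand2, e1]
  ring

/-- **THE CONJUGATION DEFECT OF `‖D_uφ‖²` (IMS localization formula, additive form)**: for EVERY real weight `ω` (which may vanish) and
every `U(1)` field, `‖D_u(ωφ)‖² − ⟨D_uφ, D_u(ω²φ)⟩ = c²Σ_b(ω(b₊) − ω(b₋))²·Re(\overline{u_bφ(b₊)}φ(b₋))`, hence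
`≤ c²Σ_b(ω(b₊) − ω(b₋))²·‖φ(b₊)‖·‖φ(b₋)‖` — second order in the oscillation of the weight, no positivity of `ω` needed (p33's
`BIJ85AgmonDefect.defect_D_le` is the multiplicative form for `ω > 0`). [cite: BalabanImbrieJaffe1985, (4.6.3) p.313] -/
theorem defect_D_le_add (c : ℝ) (U : GaugeField P j U1) (ω : Balaban1983to89.Site P j → ℝ) (φ : FineSp P j) :
    ‖Dlin c U (wmul ω φ)‖ ^ 2 - ⟪Dlin c U φ, Dlin c U (wmul ω (wmul ω φ))⟫
      ≤ c ^ 2 * ∑ b : PBond P j, (ω b.tgt - ω b.src) ^ 2 * (‖φ b.tgt‖ * ‖φ b.src‖) := by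
  rw [PiLp.norm_sq_eq_of_L2, inner_eq_re_sum, ← Finset.sum_sub_distrib, Finset.mul_sum]
  refine Finset.sum_le_sum fun b _ => ?_
  -- the three covariant differences at the bond `b`
  set A : ℂ := toC (U b) * φ b.tgt with hA
  set B : ℂ := φ b.src with hB
  have e1 : Dlin c U (wmul ω φ) b = (c : ℂ) * ((ω b.tgt : ℂ) * A - (ω b.src : ℂ) * B) := by
    rw [Dlin_apply]; simp only [covD, cfg, hA, hB]
    show (c : ℂ) * (toC (U b) * ((ω b.tgt : ℂ) * φ b.tgt) - (ω b.src : ℂ) * φ b.src) = _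
    ring
  have e0 : Dlin c U φ b = (c : ℂ) * (A - B) := by
    rw [Dlin_apply]; simp only [covD, cfg, hA, hB]
  have e2 : Dlin c U (wmul ω (wmul ω φ)) b = (c : ℂ) * ((ω b.tgt : ℂ) ^ 2 * A - (ω b.src : ℂ) ^ 2 * B) := by
    rw [wmul_wmul, Dlin_apply]; simp only [covD, cfg, hA, hB]
    show (c : ℂ) * (toC (U b) * (((ω b.tgt * ω b.tgt : ℝ) : ℂ) * φ b.tgt) - ((ω b.src * ω b.src : ℝ) : ℂ) * φ b.src) = _
    push_cast; ring
  rw [e1, e0, e2, norm_mul, mul_pow, Complex.norm_real, Real.norm_eq_abs, sq_abs]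
  have h3 : (conj ((c : ℂ) * (A - B)) * ((c : ℂ) * ((ω b.tgt : ℂ) ^ 2 * A - (ω b.src : ℂ) ^ 2 * B))).re =
      c ^ 2 * (conj (A - B) * ((ω b.tgt : ℂ) ^ 2 * A - (ω b.src : ℂ) ^ 2 * B)).re := by
    have : conj ((c : ℂ) * (A - B)) * ((c : ℂ) * ((ω b.tgt : ℂ) ^ 2 * A - (ω b.src : ℂ) ^ 2 * B)) =
        ((c ^ 2 : ℝ) : ℂ) * (conj (A - B) * ((ω b.tgt : ℂ) ^ 2 * A - (ω b.src : ℂ) ^ 2 * B)) := by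
      rw [map_mul, Complex.conj_ofReal]; push_cast; ring
    rw [this, Complex.re_ofReal_mul]
  rw [h3, ← mul_sub, bond_defect_identity]
  refine mul_le_mul_of_nonneg_left (mul_le_mul_of_nonneg_left ?_ (sq_nonneg _)) (sq_nonneg _)
  calc (conj A * B).re ≤ ‖conj A * B‖ := Complex.re_le_norm _
    _ = ‖φ b.tgt‖ * ‖φ b.src‖ := by rw [norm_mul, Complex.norm_conj, hA, norm_mul, norm_toC, one_mul]

/-- kernel: the symmetrised double sum — for a symmetric real kernel `R` on a finite set,
`Σ_{x,x′}(ω_xω_{x′} − ω_{x′}²)R_{xx′} = −½Σ_{x,x′}(ω_x − ω_{x′})²R_{xx′}`. [folklore] -/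
private theorem symm_double_sum {ι : Type*} (s : Finset ι) (ω : ι → ℝ) (R : ι → ι → ℝ) (hR : ∀ x x', R x x' = R x' x) :
    ∑ x ∈ s, ∑ x' ∈ s, (ω x * ω x' - ω x' ^ 2) * R x x' = -(1 / 2) * ∑ x ∈ s, ∑ x' ∈ s, (ω x - ω x') ^ 2 * R x x' := by
  have h1 : ∑ x ∈ s, ∑ x' ∈ s, ω x' ^ 2 * R x x' = ∑ x ∈ s, ∑ x' ∈ s, ω x ^ 2 * R x x' := by
    rw [Finset.sum_comm]
    exact Finset.sum_congr rfl fun x _ => Finset.sum_congr rfl fun x' _ => by rw [hR]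
  have h2 : ∑ x ∈ s, ∑ x' ∈ s, (ω x * ω x' - ω x' ^ 2) * R x x' =
      ∑ x ∈ s, ∑ x' ∈ s, ω x * ω x' * R x x' - ∑ x ∈ s, ∑ x' ∈ s, ω x' ^ 2 * R x x' := by
    rw [← Finset.sum_sub_distrib]
    exact Finset.sum_congr rfl fun x _ => by rw [← Finset.sum_sub_distrib]; exact Finset.sum_congr rfl fun x' _ => by ring
  have h3 : ∑ x ∈ s, ∑ x' ∈ s, (ω x - ω x') ^ 2 * R x x' =
      ∑ x ∈ s, ∑ x' ∈ s, ω x ^ 2 * R x x' - 2 * ∑ x ∈ s, ∑ x' ∈ s, ω x * ω x' * R x x' + ∑ x ∈ s, ∑ x' ∈ s, ω x' ^ 2 * R x x' := by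
    rw [Finset.mul_sum, ← Finset.sum_sub_distrib, ← Finset.sum_add_distrib]
    refine Finset.sum_congr rfl fun x _ => ?_
    rw [Finset.mul_sum, ← Finset.sum_sub_distrib, ← Finset.sum_add_distrib]
    exact Finset.sum_congr rfl fun x' _ => by ring
  rw [h2, h3, h1]
  ring

/-- **THE CONJUGATION DEFECT OF `‖Q_k(u)φ‖²` (IMS, additive form)**: for EVERY real weight `ω` and every `U(1)` field,
`‖Q_k(u)(ωφ)‖² − ⟨Q_k(u)φ, Q_k(u)(ω²φ)⟩ ≤ ½N⁻²·Σ_y Σ_{x,x′∈B^k(y)}(ω_x − ω_{x′})²‖φ_x‖‖φ_{x′}‖` (`N = L^{kd}`; the covariant average is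
the rank-one form with coefficients `N⁻¹u(Γ^{(k)}_{x_k,x})` of modulus `N⁻¹`; exact value `−½N⁻²ΣΣΣ(ω_x − ω_{x′})²Re(\overline{h_xφ_x}h_{x′}φ_{x′})`).
[cite: BalabanImbrieJaffe1985, (4.6.1) p.313] -/
theorem defect_Q_le_add {k : ℕ} (U : GaugeField P j U1) (ω : Balaban1983to89.Site P j → ℝ) (φ : FineSp P j) :
    ‖QlinK U k (wmul ω φ)‖ ^ 2 - ⟪QlinK U k φ, QlinK U k (wmul ω (wmul ω φ))⟫
      ≤ (1 / 2) * (((P.L : ℝ) ^ (k * P.d))⁻¹) ^ 2 *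
          ∑ y : Balaban1983to89.Site P (j + k), ∑ x ∈ blockK k y, ∑ x' ∈ blockK k y, (ω x - ω x') ^ 2 * (‖φ x‖ * ‖φ x'‖) := by
  rw [PiLp.norm_sq_eq_of_L2, inner_eq_re_sum, ← Finset.sum_sub_distrib, Finset.mul_sum]
  refine Finset.sum_le_sum fun y _ => ?_
  set Nc : ℂ := ((P.L : ℂ) ^ (k * P.d))⁻¹ with hNc
  set g : Balaban1983to89.Site P j → ℂ := fun x => holCK U k x * φ x with hg
  have hNc_real : Nc = (((((P.L : ℝ) ^ (k * P.d))⁻¹ : ℝ)) : ℂ) := by rw [hNc]; push_cast; rfl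
  have e1 : QlinK U k (wmul ω φ) y = Nc * ∑ x ∈ blockK k y, (ω x : ℂ) * g x := by
    rw [QlinK_apply, qCovK_apply]
    congr 1
    refine Finset.sum_congr rfl fun x _ => ?_
    show holCK U k x * ((ω x : ℂ) * φ x) = (ω x : ℂ) * (holCK U k x * φ x)
    ring
  have e0 : QlinK U k φ y = Nc * ∑ x ∈ blockK k y, g x := by
    rw [QlinK_apply, qCovK_apply]
  have e2 : QlinK U k (wmul ω (wmul ω φ)) y = Nc * ∑ x ∈ blockK k y, ((ω x : ℂ)) ^ 2 * g x := by
    rw [wmul_wmul, QlinK_apply, qCovK_apply]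
    congr 1
    refine Finset.sum_congr rfl fun x _ => ?_
    show holCK U k x * (((ω x * ω x : ℝ) : ℂ) * φ x) = (ω x : ℂ) ^ 2 * (holCK U k x * φ x)
    push_cast; ring
  -- the symmetric real kernel
  set R : Balaban1983to89.Site P j → Balaban1983to89.Site P j → ℝ := fun x x' => (conj (g x) * g x').re with hR
  have hRsymm : ∀ x x', R x x' = R x' x := fun x x' => re_conj_mul_comm (g x) (g x')
  have hRle : ∀ x x', |R x x'| ≤ ‖φ x‖ * ‖φ x'‖ := by
    intro x x'
    calc |R x x'| ≤ ‖conj (g x) * g x'‖ := Complex.abs_re_le_norm _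
      _ = ‖φ x‖ * ‖φ x'‖ := by rw [norm_mul, Complex.norm_conj, hg, norm_mul, norm_mul, norm_holCK, norm_holCK, one_mul, one_mul]
  -- the two quadratic expressions as double sums
  have h1 : ‖Nc * ∑ x ∈ blockK k y, (ω x : ℂ) * g x‖ ^ 2 =
      (((P.L : ℝ) ^ (k * P.d))⁻¹) ^ 2 * ∑ x ∈ blockK k y, ∑ x' ∈ blockK k y, ω x * ω x' * R x x' := by
    rw [norm_mul, mul_pow, hNc_real, Complex.norm_real, Real.norm_eq_abs, sq_abs, norm_sq_eq_re, map_sum, Finset.sum_mul_sum,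
      Complex.re_sum]
    congr 1
    refine Finset.sum_congr rfl fun x _ => ?_
    rw [Complex.re_sum]
    refine Finset.sum_congr rfl fun x' _ => ?_
    have : conj ((ω x : ℂ) * g x) * ((ω x' : ℂ) * g x') = ((ω x * ω x' : ℝ) : ℂ) * (conj (g x) * g x') := by
      rw [map_mul, Complex.conj_ofReal]; push_cast; ring
    rw [this, Complex.re_ofReal_mul]
  have h2 : (conj (Nc * ∑ x ∈ blockK k y, g x) * (Nc * ∑ x ∈ blockK k y, ((ω x : ℂ)) ^ 2 * g x)).re =
      (((P.L : ℝ) ^ (k * P.d))⁻¹) ^ 2 * ∑ x ∈ blockK k y, ∑ x' ∈ blockK k y, ω x' ^ 2 * R x x' := by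
    have : conj (Nc * ∑ x ∈ blockK k y, g x) * (Nc * ∑ x ∈ blockK k y, ((ω x : ℂ)) ^ 2 * g x) =
        (((((P.L : ℝ) ^ (k * P.d))⁻¹) ^ 2 : ℝ) : ℂ) * ((conj (∑ x ∈ blockK k y, g x)) * ∑ x ∈ blockK k y, ((ω x : ℂ)) ^ 2 * g x) := by
      rw [map_mul, hNc_real, Complex.conj_ofReal]; push_cast; ring
    rw [this, Complex.re_ofReal_mul, map_sum, Finset.sum_mul_sum, Complex.re_sum]
    congr 1
    refine Finset.sum_congr rfl fun x _ => ?_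
    rw [Complex.re_sum]
    refine Finset.sum_congr rfl fun x' _ => ?_
    have : conj (g x) * ((ω x' : ℂ) ^ 2 * g x') = ((ω x' ^ 2 : ℝ) : ℂ) * (conj (g x) * g x') := by push_cast; ring
    rw [this, Complex.re_ofReal_mul]
  rw [e1, e0, e2, h1, h2, ← mul_sub, ← Finset.sum_sub_distrib]
  have h3 : ∑ x ∈ blockK k y, (∑ x' ∈ blockK k y, ω x * ω x' * R x x' - ∑ x' ∈ blockK k y, ω x' ^ 2 * R x x') =
      ∑ x ∈ blockK k y, ∑ x' ∈ blockK k y, (ω x * ω x' - ω x' ^ 2) * R x x' := by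
    refine Finset.sum_congr rfl fun x _ => ?_
    rw [← Finset.sum_sub_distrib]
    exact Finset.sum_congr rfl fun x' _ => by ring
  rw [h3, symm_double_sum _ ω R hRsymm]
  have hN : 0 ≤ (((P.L : ℝ) ^ (k * P.d))⁻¹) ^ 2 := sq_nonneg _
  calc (((P.L : ℝ) ^ (k * P.d))⁻¹) ^ 2 * (-(1 / 2) * ∑ x ∈ blockK k y, ∑ x' ∈ blockK k y, (ω x - ω x') ^ 2 * R x x')
      = (1 / 2) * (((P.L : ℝ) ^ (k * P.d))⁻¹) ^ 2 * ∑ x ∈ blockK k y, ∑ x' ∈ blockK k y, (ω x - ω x') ^ 2 * (-R x x') := by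
        rw [Finset.mul_sum, Finset.mul_sum, Finset.mul_sum]
        refine Finset.sum_congr rfl fun x _ => ?_
        rw [Finset.mul_sum, Finset.mul_sum, Finset.mul_sum]
        exact Finset.sum_congr rfl fun x' _ => by ring
    _ ≤ (1 / 2) * (((P.L : ℝ) ^ (k * P.d))⁻¹) ^ 2 * ∑ x ∈ blockK k y, ∑ x' ∈ blockK k y, (ω x - ω x') ^ 2 * (‖φ x‖ * ‖φ x'‖) := by
        refine mul_le_mul_of_nonneg_left (Finset.sum_le_sum fun x _ => Finset.sum_le_sum fun x' _ => ?_) (by positivity)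
        exact mul_le_mul_of_nonneg_left ((neg_le_abs _).trans (hRle x x')) (sq_nonneg _)

/-! ## §2 The energy of a weighted harmonic function is the sum of the two defects -/

/-- **THE IMS BOUND FOR A LOCALLY HARMONIC FUNCTION**: if `(Tφ)(x) = 0` at every site where the real weight `ω` does not vanish
(`T = D_u^*D_u + aQ_k(u)^*Q_k(u)` of (4.6.2), `a ≥ 0`), then the energy of the weighted function is carried by the oscillation of the
weight alone: `‖D_u(ωφ)‖² + a‖Q_k(u)(ωφ)‖² ≤ c²Σ_b(ω₊ − ω₋)²‖φ₊‖‖φ₋‖ + (a/2)N⁻²Σ_yΣ_{x,x′∈B^k(y)}(ω_x − ω_{x′})²‖φ_x‖‖φ_{x′}‖` — the discrete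
IMS localization formula `⟨ωφ, T(ωφ)⟩ = Re⟨ω²φ, Tφ⟩ + defects` with `Re⟨ω²φ, Tφ⟩ = 0`. [cite: BalabanImbrieJaffe1985, (4.6.2) p.313] -/
theorem energy_wmul_le_of_harmonic {k : ℕ} (c : ℝ) {a : ℝ} (ha : 0 ≤ a) (U : GaugeField P j U1) (ω : Balaban1983to89.Site P j → ℝ)
    (φ : FineSp P j) (hT : ∀ x, ω x ≠ 0 → opT (Dlin c U) (QlinK U k) a φ x = 0) :
    ‖Dlin c U (wmul ω φ)‖ ^ 2 + a * ‖QlinK U k (wmul ω φ)‖ ^ 2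
      ≤ c ^ 2 * ∑ b : PBond P j, (ω b.tgt - ω b.src) ^ 2 * (‖φ b.tgt‖ * ‖φ b.src‖)
        + a * ((1 / 2) * (((P.L : ℝ) ^ (k * P.d))⁻¹) ^ 2 *
          ∑ y : Balaban1983to89.Site P (j + k), ∑ x ∈ blockK k y, ∑ x' ∈ blockK k y, (ω x - ω x') ^ 2 * (‖φ x‖ * ‖φ x'‖)) := by
  have h0 : ⟪opT (Dlin c U) (QlinK U k) a φ, wmul ω (wmul ω φ)⟫ = 0 := by
    rw [inner_eq_re_sum]
    refine Finset.sum_eq_zero fun x _ => ?_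
    by_cases hx : ω x = 0
    · rw [wmul_wmul, wmul_apply, hx, zero_mul, Complex.ofReal_zero, zero_mul, mul_zero, Complex.zero_re]
    · rw [hT x hx, map_zero, zero_mul, Complex.zero_re]
  have h1 := inner_opT_left c a U φ (wmul ω (wmul ω φ)) (k := k)
  rw [h0] at h1
  have hD := defect_D_le_add c U ω φ
  have hQ := mul_le_mul_of_nonneg_left (defect_Q_le_add (k := k) U ω φ) ha
  nlinarith [hD, hQ, h1]

/-- **THE COERCIVE FORM**: under the block-scale plaquette smallness `2d³(L^{2k}θ)² ≤ 1` (`θ = max‖u(∂p) − 1‖`, `a > 0`, `j + k ≤ m + K`),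
p33's coercivity `m₀‖ψ‖² ≤ ‖D_uψ‖² + a‖Q_k(u)ψ‖²` (`m₀ = min(a/2, c²N/(4n²))/N`, `n = L^k`, `N = L^{kd}`) applied to `ψ = ωφ` turns §2 into
`m₀‖ωφ‖² ≤ (the two defect sums)` for every locally `T`-harmonic `φ`. [cite: BalabanImbrieJaffe1985, (4.6.2) p.313, (7.3.1) p.326] -/
theorem coercive_wmul_le_of_harmonic {k : ℕ} (hk : j + k ≤ P.m + P.K) (c : ℝ) {a : ℝ} (ha : 0 < a) (U : GaugeField P j U1) {θ : ℝ}
    (hθ : ∀ (x : Balaban1983to89.Site P j) (μ ν : Fin P.d), ‖plaqC U x μ ν - 1‖ ≤ θ)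
    (hsmall : 2 * (P.d : ℝ) ^ 3 * (((P.L : ℝ) ^ k) ^ 2 * θ) ^ 2 ≤ 1) (ω : Balaban1983to89.Site P j → ℝ) (φ : FineSp P j)
    (hT : ∀ x, ω x ≠ 0 → opT (Dlin c U) (QlinK U k) a φ x = 0) :
    min (a / 2) (c ^ 2 * (P.L : ℝ) ^ (k * P.d) / (4 * ((P.L : ℝ) ^ k) ^ 2)) / (P.L : ℝ) ^ (k * P.d) * ‖wmul ω φ‖ ^ 2
      ≤ c ^ 2 * ∑ b : PBond P j, (ω b.tgt - ω b.src) ^ 2 * (‖φ b.tgt‖ * ‖φ b.src‖)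
        + a * ((1 / 2) * (((P.L : ℝ) ^ (k * P.d))⁻¹) ^ 2 *
          ∑ y : Balaban1983to89.Site P (j + k), ∑ x ∈ blockK k y, ∑ x' ∈ blockK k y, (ω x - ω x') ^ 2 * (‖φ x‖ * ‖φ x'‖)) := by
  have h1 := coercive_opT hk c ha U hθ hsmall (wmul ω φ)
  rw [inner_opT] at h1
  exact h1.trans (energy_wmul_le_of_harmonic c ha.le U ω φ hT)

/-! ## §3 Bookkeeping: the symmetrised block defect, Lipschitz weights, sums over balls -/

/-- kernel: **symmetrisation of the block defect** — for a weight function `Wt` symmetric in `(x, x′)` and nonnegative,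
`Σ_{x,x′∈B}Wt(x,x′)‖φ_x‖‖φ_{x′}‖ ≤ Σ_{x,x′∈B}Wt(x,x′)‖φ_x‖²`. [folklore] -/
private theorem double_sum_mul_le_sq {ι : Type*} (s : Finset ι) (Wt : ι → ι → ℝ) (hW : ∀ x x', Wt x x' = Wt x' x) (hW0 : ∀ x x', 0 ≤ Wt x x')
    (n : ι → ℝ) :
    ∑ x ∈ s, ∑ x' ∈ s, Wt x x' * (n x * n x') ≤ ∑ x ∈ s, ∑ x' ∈ s, Wt x x' * n x ^ 2 := by
  have h1 : ∑ x ∈ s, ∑ x' ∈ s, Wt x x' * n x' ^ 2 = ∑ x ∈ s, ∑ x' ∈ s, Wt x x' * n x ^ 2 := by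
    rw [Finset.sum_comm]
    exact Finset.sum_congr rfl fun x _ => Finset.sum_congr rfl fun x' _ => by rw [hW]
  have h2 : ∑ x ∈ s, ∑ x' ∈ s, Wt x x' * (n x * n x') ≤ ∑ x ∈ s, ∑ x' ∈ s, Wt x x' * ((n x ^ 2 + n x' ^ 2) / 2) :=
    Finset.sum_le_sum fun x _ => Finset.sum_le_sum fun x' _ =>
      mul_le_mul_of_nonneg_left (by nlinarith [sq_nonneg (n x - n x')]) (hW0 x x')
  refine h2.trans (le_of_eq ?_)
  have h3 : ∑ x ∈ s, ∑ x' ∈ s, Wt x x' * ((n x ^ 2 + n x' ^ 2) / 2) =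
      (∑ x ∈ s, ∑ x' ∈ s, Wt x x' * n x ^ 2 + ∑ x ∈ s, ∑ x' ∈ s, Wt x x' * n x' ^ 2) / 2 := by
    rw [← Finset.sum_add_distrib, Finset.sum_div]
    refine Finset.sum_congr rfl fun x _ => ?_
    rw [← Finset.sum_add_distrib, Finset.sum_div]
    exact Finset.sum_congr rfl fun x' _ => by ring
  rw [h3, h1]; ring

/-- kernel: **the tent is `1/r`-Lipschitz in the distance**: `|T_r(t) − T_r(t′)| ≤ |t − t′|/r` (telescoping the unit steps).
[cite: BalabanImbrieJaffe1985, p.326] -/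
theorem abs_tentN_sub_le {r : ℕ} (hr : 1 ≤ r) (t t' : ℕ) : |tentN r t - tentN r t'| ≤ (Nat.dist t t' : ℝ) / r := by
  -- telescoping along `t′, t′+1, …, t′+n`
  have key : ∀ n t₀ : ℕ, |tentN r (t₀ + n) - tentN r t₀| ≤ (n : ℝ) / r := by
    intro n
    induction n with
    | zero => intro t₀; simp
    | succ n ih =>
      intro t₀
      have h1 := ih t₀
      have h2 := abs_tentN_succ_sub_le hr (t₀ + n)
      rw [show t₀ + (n + 1) = t₀ + n + 1 by ring]
      calc |tentN r (t₀ + n + 1) - tentN r t₀|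
          = |(tentN r (t₀ + n + 1) - tentN r (t₀ + n)) + (tentN r (t₀ + n) - tentN r t₀)| := by ring_nf
        _ ≤ |tentN r (t₀ + n + 1) - tentN r (t₀ + n)| + |tentN r (t₀ + n) - tentN r t₀| := abs_add_le _ _
        _ ≤ 1 / r + n / r := add_le_add h2 h1
        _ = ((n + 1 : ℕ) : ℝ) / r := by push_cast; ring
  rcases le_total t' t with h | h
  · obtain ⟨n, rfl⟩ := Nat.exists_eq_add_of_le h
    rw [Nat.dist_comm, Nat.dist_eq_sub_of_le h, Nat.add_sub_cancel_left]
    exact key n t'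
  · obtain ⟨n, rfl⟩ := Nat.exists_eq_add_of_le h
    rw [abs_sub_comm, Nat.dist_eq_sub_of_le h, Nat.add_sub_cancel_left]
    exact key n t

/-- kernel: the sup distances from a centre differ by at most the mutual sup distance, `dist(|y₀−x|, |y₀−x′|) ≤ |x−x′|`.
[cite: BalabanImbrieJaffe1985, p.326] -/
theorem dist_supDist_le (y₀ x x' : Balaban1983to89.Site P j) : Nat.dist (supDist y₀ x) (supDist y₀ x') ≤ supDist x x' := by
  have h1 : supDist y₀ x' ≤ supDist y₀ x + supDist x x' := supDist_triangle y₀ x x'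
  have h2 : supDist y₀ x ≤ supDist y₀ x' + supDist x x' := by
    have := supDist_triangle y₀ x' x; rw [supDist_comm x' x] at this; exact this
  unfold Nat.dist; omega

/-- kernel: **the radial tent `χ(x) = T_ρ(|y₀ − x|_∞)` is `1/ρ`-Lipschitz for the sup distance**: `|χ(x) − χ(x′)| ≤ |x − x′|_∞/ρ`.
[cite: BalabanImbrieJaffe1985, p.326] -/
theorem abs_radialTent_sub_le {ρ : ℕ} (hρ : 1 ≤ ρ) (y₀ x x' : Balaban1983to89.Site P j) :
    |tentN ρ (supDist y₀ x) - tentN ρ (supDist y₀ x')| ≤ (supDist x x' : ℝ) / ρ := by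
  refine (abs_tentN_sub_le hρ _ _).trans ?_
  exact div_le_div_of_nonneg_right (by exact_mod_cast dist_supDist_le y₀ x x') (by exact_mod_cast (Nat.zero_le ρ))

/-- kernel: two sites of one `k`-block are within sup distance `L^k`. [cite: BalabanImbrieJaffe1985, (5.1.2)–(5.1.3) p.313] -/
theorem supDist_le_of_mem_blockK {k : ℕ} (hk : j + k ≤ P.m + P.K) {y : Balaban1983to89.Site P (j + k)} {x x' : Balaban1983to89.Site P j}
    (hx : x ∈ blockK k y) (hx' : x' ∈ blockK k y) : supDist x x' ≤ P.L ^ k :=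
  (BIJ85ScalarPropagatorDecay.supDist_le_of_blkIter_eq hk ((mem_blockK.1 hx).trans (mem_blockK.1 hx').symm)).trans (Nat.sub_le _ _)

/-- kernel: **a sum over shifted sites of an indicator-restricted nonnegative function**: `Σ_z Σ_μ [z+e_μ ∈ A]F(z+e_μ) = d·Σ_{x∈A}F(x)`
(each shift is a bijection of the torus). [folklore] -/
private theorem sum_sum_shift_indicator (A : Finset (Balaban1983to89.Site P j)) (F : Balaban1983to89.Site P j → ℝ) :
    ∑ z : Balaban1983to89.Site P j, ∑ μ : Fin P.d, (if z.shift μ ∈ A then F (z.shift μ) else 0) = P.d * ∑ x ∈ A, F x := by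
  rw [sum_sum_shift_dir (fun x => if x ∈ A then F x else 0), ← Finset.sum_filter, Finset.filter_mem_eq_inter, Finset.univ_inter]

/-- kernel: `Σ_z Σ_μ [z ∈ A]F(z) = d·Σ_{x∈A}F(x)`. [folklore] -/
private theorem sum_sum_indicator (A : Finset (Balaban1983to89.Site P j)) (F : Balaban1983to89.Site P j → ℝ) :
    ∑ z : Balaban1983to89.Site P j, ∑ _μ : Fin P.d, (if z ∈ A then F z else 0) = P.d * ∑ x ∈ A, F x := by
  rw [sum_sum_dir (fun x => if x ∈ A then F x else 0), ← Finset.sum_filter, Finset.filter_mem_eq_inter, Finset.univ_inter]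

/-- kernel: `Σ_y Σ_{x∈B^k(y)} F(x) = Σ_x F(x)` (the blocks partition the torus). [cite: BalabanImbrieJaffe1985, (5.1.2) p.313] -/
theorem sum_blockK_eq_sum {k : ℕ} (F : Balaban1983to89.Site P j → ℝ) :
    ∑ y : Balaban1983to89.Site P (j + k), ∑ x ∈ blockK k y, F x = ∑ x, F x :=
  Finset.sum_fiberwise (Finset.univ : Finset (Balaban1983to89.Site P j)) (blkIter k) F

/-! ## §4 THE CACCIOPPOLI INEQUALITY: the covariant energy of a harmonic function on a ball is controlled by its `ℓ²` mass on a bigger ball -/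

/-- **CACCIOPPOLI'S INEQUALITY FOR `T = D_u^*D_u + aQ_k(u)^*Q_k(u)`-HARMONIC FUNCTIONS** (every `U(1)` field, every real `c`, `a ≥ 0`,
`ρ ≥ 1`, `j + k ≤ m + K`): if `(Tφ)(x) = 0` for all `x` in the sup-ball of radius `2ρ` around `y₀`, then the covariant energy on the ball of
radius `ρ − 1` is bounded by the `ℓ²` mass on the ball of radius `2ρ + L^k`:
`c²·Σ_{|z−y₀|≤ρ−1}Σ_μ‖u_{z,μ}φ(z+e_μ) − φ(z)‖² ≤ ρ⁻²·(d·c² + (a/2)N⁻¹(L^k)²)·Σ_{|x−y₀|≤2ρ+L^k}‖φ(x)‖²` — §2 with the radial tent of flat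
radius `ρ` (its bond oscillation `≤ ρ⁻¹`, its block oscillation `≤ L^k/ρ`), the energy of `T_ρφ` bounding the energy of `φ` where the tent is
`1`. [cite: BalabanImbrieJaffe1985, (4.6.2) p.313, p.326] [cite: Balaban1983RegularityDecay, Theorem p.573 (1.10)–(1.12)] -/
theorem caccioppoli {k : ℕ} (hk : j + k ≤ P.m + P.K) (c : ℝ) {a : ℝ} (ha : 0 ≤ a) (U : GaugeField P j U1) (φ : FineSp P j)
    (y₀ : Balaban1983to89.Site P j) {ρ : ℕ} (hρ : 1 ≤ ρ)
    (hT : ∀ x, supDist y₀ x ≤ 2 * ρ → opT (Dlin c U) (QlinK U k) a φ x = 0) :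
    c ^ 2 * ∑ z ∈ ball y₀ (ρ - 1), ∑ μ : Fin P.d, ‖toC (U ⟨z, μ⟩) * φ (z.shift μ) - φ z‖ ^ 2
      ≤ (ρ : ℝ)⁻¹ ^ 2 * (P.d * c ^ 2 + a / 2 * ((P.L : ℝ) ^ (k * P.d))⁻¹ * ((P.L : ℝ) ^ k) ^ 2) *
          ∑ x ∈ ball y₀ (2 * ρ + P.L ^ k), ‖φ x‖ ^ 2 := by
  set η : Balaban1983to89.Site P j → ℝ := fun x => tentN ρ (supDist y₀ x) with hηdef
  have hρ0 : (0 : ℝ) < ρ := by exact_mod_cast hρ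
  have hN : (0 : ℝ) < (P.L : ℝ) ^ (k * P.d) := pow_pos P.cast_L_pos _
  have hη01 : ∀ x, 0 ≤ η x ∧ η x ≤ 1 := fun x => ⟨tentN_nonneg _ _, tentN_le_one hρ _⟩
  have hηone : ∀ x, supDist y₀ x ≤ ρ → η x = 1 := fun x hx => tentN_of_le hx
  have hηzero : ∀ x, 2 * ρ ≤ supDist y₀ x → η x = 0 := fun x hx => tentN_of_ge hρ hx
  have hηL : ∀ x x', |η x - η x'| ≤ (supDist x x' : ℝ) / ρ := fun x x' => abs_radialTent_sub_le hρ y₀ x x'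
  -- the harmonic hypothesis on the support of the tent
  have hT' : ∀ x, η x ≠ 0 → opT (Dlin c U) (QlinK U k) a φ x = 0 := by
    intro x hx
    refine hT x ?_
    by_contra h
    exact hx (hηzero x (by omega))
  have hmain := energy_wmul_le_of_harmonic c ha U η φ hT'
  -- (1) the left side dominates the energy on the small ball
  have hLHS : c ^ 2 * ∑ z ∈ ball y₀ (ρ - 1), ∑ μ : Fin P.d, ‖toC (U ⟨z, μ⟩) * φ (z.shift μ) - φ z‖ ^ 2 ≤ ‖Dlin c U (wmul η φ)‖ ^ 2 := by
    rw [norm_Dlin_sq, sum_bond_eq, Finset.mul_sum]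
    have hnn : ∀ z ∈ (Finset.univ : Finset (Balaban1983to89.Site P j)), z ∉ ball y₀ (ρ - 1) →
        0 ≤ ∑ μ : Fin P.d, ‖(c : ℂ) * (toC (U (⟨z, μ⟩ : PBond P j)) * (wmul η φ) (PBond.tgt ⟨z, μ⟩) - (wmul η φ) (PBond.src ⟨z, μ⟩))‖ ^ 2 :=
      fun z _ _ => Finset.sum_nonneg fun μ _ => sq_nonneg _
    refine le_trans ?_ (Finset.sum_le_sum_of_subset_of_nonneg (Finset.subset_univ (ball y₀ (ρ - 1))) hnn)
    refine Finset.sum_le_sum fun z hz => ?_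
    rw [Finset.mul_sum]
    refine Finset.sum_le_sum fun μ _ => le_of_eq ?_
    have hz' := mem_ball.1 hz
    have h1 : η z = 1 := hηone z (by omega)
    have h2 : η (z.shift μ) = 1 := hηone _ ((BIJ85TorusTentCutoff.supDist_shift_le_succ y₀ z μ).trans (by omega))
    show c ^ 2 * ‖toC (U ⟨z, μ⟩) * φ (z.shift μ) - φ z‖ ^ 2 =
      ‖(c : ℂ) * (toC (U ⟨z, μ⟩) * wmul η φ (z.shift μ) - wmul η φ z)‖ ^ 2
    rw [wmul_apply, wmul_apply, h1, h2, Complex.ofReal_one, one_mul, one_mul, norm_mul, Complex.norm_real, Real.norm_eq_abs, mul_pow,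
      sq_abs]
  -- (2) the bond defect
  have hD : c ^ 2 * ∑ b : PBond P j, (η b.tgt - η b.src) ^ 2 * (‖φ b.tgt‖ * ‖φ b.src‖) ≤
      c ^ 2 * ((ρ : ℝ)⁻¹ ^ 2 * (P.d * ∑ x ∈ ball y₀ (2 * ρ + P.L ^ k), ‖φ x‖ ^ 2)) := by
    refine mul_le_mul_of_nonneg_left ?_ (sq_nonneg _)
    rw [sum_bond_eq]
    -- per bond: `(Δη)²‖φ₊‖‖φ₋‖ ≤ ρ⁻²/2·([b₋ ∈ B]‖φ₋‖² + [b₊ ∈ B]‖φ₊‖²)`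
    have hb : ∀ (z : Balaban1983to89.Site P j) (μ : Fin P.d),
        (η (z.shift μ) - η z) ^ 2 * (‖φ (z.shift μ)‖ * ‖φ z‖) ≤
          (ρ : ℝ)⁻¹ ^ 2 / 2 * (if z ∈ ball y₀ (2 * ρ + P.L ^ k) then ‖φ z‖ ^ 2 else 0) +
            (ρ : ℝ)⁻¹ ^ 2 / 2 * (if z.shift μ ∈ ball y₀ (2 * ρ + P.L ^ k) then ‖φ (z.shift μ)‖ ^ 2 else 0) := by
      intro z μ
      have hL1 : 1 ≤ P.L ^ k := Nat.one_le_pow _ _ P.L_pos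
      by_cases hfar : 2 * ρ + 1 ≤ supDist y₀ z
      · have h1 : η z = 0 := hηzero z (by omega)
        have h2 : η (z.shift μ) = 0 := hηzero _ (by have := BIJ85TorusTentCutoff.supDist_le_shift_succ y₀ z μ; omega)
        rw [h1, h2, sub_self]
        have : 0 ≤ (ρ : ℝ)⁻¹ ^ 2 / 2 * (if z ∈ ball y₀ (2 * ρ + P.L ^ k) then ‖φ z‖ ^ 2 else 0) +
            (ρ : ℝ)⁻¹ ^ 2 / 2 * (if z.shift μ ∈ ball y₀ (2 * ρ + P.L ^ k) then ‖φ (z.shift μ)‖ ^ 2 else 0) := by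
          positivity
        simpa using this
      · push Not at hfar
        have hz : z ∈ ball y₀ (2 * ρ + P.L ^ k) := mem_ball.2 (by omega)
        have hz' : z.shift μ ∈ ball y₀ (2 * ρ + P.L ^ k) :=
          mem_ball.2 ((BIJ85TorusTentCutoff.supDist_shift_le_succ y₀ z μ).trans (by omega))
        rw [if_pos hz, if_pos hz']
        have hΔ : (η (z.shift μ) - η z) ^ 2 ≤ (ρ : ℝ)⁻¹ ^ 2 := by
          have h1 := hηL (z.shift μ) z
          have h2 : (supDist (z.shift μ) z : ℝ) ≤ 1 := by
            rw [supDist_comm]; exact_mod_cast BIJ85TorusTentCutoff.supDist_shift_le_one' z μ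
          have h3 : |η (z.shift μ) - η z| ≤ (ρ : ℝ)⁻¹ := h1.trans (by rw [div_le_iff₀ hρ0, inv_mul_cancel₀ hρ0.ne']; exact h2)
          calc (η (z.shift μ) - η z) ^ 2 = |η (z.shift μ) - η z| ^ 2 := (sq_abs _).symm
            _ ≤ (ρ : ℝ)⁻¹ ^ 2 := pow_le_pow_left₀ (abs_nonneg _) h3 2
        have hprod : ‖φ (z.shift μ)‖ * ‖φ z‖ ≤ (‖φ z‖ ^ 2 + ‖φ (z.shift μ)‖ ^ 2) / 2 := by
          nlinarith [sq_nonneg (‖φ (z.shift μ)‖ - ‖φ z‖)]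
        calc (η (z.shift μ) - η z) ^ 2 * (‖φ (z.shift μ)‖ * ‖φ z‖)
            ≤ (ρ : ℝ)⁻¹ ^ 2 * ((‖φ z‖ ^ 2 + ‖φ (z.shift μ)‖ ^ 2) / 2) := mul_le_mul hΔ hprod (by positivity) (by positivity)
          _ = _ := by ring
    have e1 := sum_sum_indicator (ball y₀ (2 * ρ + P.L ^ k)) (fun x => ‖φ x‖ ^ 2)
    have e2 := sum_sum_shift_indicator (ball y₀ (2 * ρ + P.L ^ k)) (fun x => ‖φ x‖ ^ 2)
    calc ∑ z, ∑ μ : Fin P.d, (η (PBond.tgt ⟨z, μ⟩) - η (PBond.src ⟨z, μ⟩)) ^ 2 * (‖φ (PBond.tgt ⟨z, μ⟩)‖ * ‖φ (PBond.src ⟨z, μ⟩)‖)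
        ≤ ∑ z, ∑ μ : Fin P.d, ((ρ : ℝ)⁻¹ ^ 2 / 2 * (if z ∈ ball y₀ (2 * ρ + P.L ^ k) then ‖φ z‖ ^ 2 else 0) +
            (ρ : ℝ)⁻¹ ^ 2 / 2 * (if z.shift μ ∈ ball y₀ (2 * ρ + P.L ^ k) then ‖φ (z.shift μ)‖ ^ 2 else 0)) :=
          Finset.sum_le_sum fun z _ => Finset.sum_le_sum fun μ _ => hb z μ
      _ = (ρ : ℝ)⁻¹ ^ 2 / 2 * ∑ z : Balaban1983to89.Site P j, ∑ _μ : Fin P.d, (if z ∈ ball y₀ (2 * ρ + P.L ^ k) then ‖φ z‖ ^ 2 else 0) +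
            (ρ : ℝ)⁻¹ ^ 2 / 2 * ∑ z : Balaban1983to89.Site P j, ∑ μ : Fin P.d,
              (if z.shift μ ∈ ball y₀ (2 * ρ + P.L ^ k) then ‖φ (z.shift μ)‖ ^ 2 else 0) := by
          rw [Finset.mul_sum, Finset.mul_sum, ← Finset.sum_add_distrib]
          refine Finset.sum_congr rfl fun z _ => ?_
          rw [Finset.mul_sum, Finset.mul_sum, ← Finset.sum_add_distrib]
      _ = (ρ : ℝ)⁻¹ ^ 2 * (P.d * ∑ x ∈ ball y₀ (2 * ρ + P.L ^ k), ‖φ x‖ ^ 2) := by rw [e1, e2]; ring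
  -- (3) the block defect
  have hQ : (1 / 2) * (((P.L : ℝ) ^ (k * P.d))⁻¹) ^ 2 *
        ∑ y : Balaban1983to89.Site P (j + k), ∑ x ∈ blockK k y, ∑ x' ∈ blockK k y, (η x - η x') ^ 2 * (‖φ x‖ * ‖φ x'‖) ≤
      (1 / 2) * ((P.L : ℝ) ^ (k * P.d))⁻¹ * ((ρ : ℝ)⁻¹ ^ 2 * ((P.L : ℝ) ^ k) ^ 2) * ∑ x ∈ ball y₀ (2 * ρ + P.L ^ k), ‖φ x‖ ^ 2 := by
    have hy : ∀ y : Balaban1983to89.Site P (j + k),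
        ∑ x ∈ blockK k y, ∑ x' ∈ blockK k y, (η x - η x') ^ 2 * (‖φ x‖ * ‖φ x'‖) ≤
          ∑ x ∈ blockK k y, (P.L : ℝ) ^ (k * P.d) * ((ρ : ℝ)⁻¹ ^ 2 * ((P.L : ℝ) ^ k) ^ 2) *
            (if x ∈ ball y₀ (2 * ρ + P.L ^ k) then ‖φ x‖ ^ 2 else 0) := by
      intro y
      refine (double_sum_mul_le_sq _ (fun x x' => (η x - η x') ^ 2) (fun x x' => by ring) (fun x x' => sq_nonneg _) _).trans ?_
      refine Finset.sum_le_sum fun x hx => ?_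
      -- `Σ_{x′∈B(y)}(η_x − η_{x′})² ≤ N·(L^k/ρ)²·[x ∈ B_{2ρ+L^k}]`
      have hterm : ∀ x' ∈ blockK k y, (η x - η x') ^ 2 * ‖φ x‖ ^ 2 ≤
          ((ρ : ℝ)⁻¹ ^ 2 * ((P.L : ℝ) ^ k) ^ 2) * (if x ∈ ball y₀ (2 * ρ + P.L ^ k) then ‖φ x‖ ^ 2 else 0) := by
        intro x' hx'
        have hd : supDist x x' ≤ P.L ^ k := supDist_le_of_mem_blockK hk hx hx'
        by_cases hxb : x ∈ ball y₀ (2 * ρ + P.L ^ k)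
        · rw [if_pos hxb]
          refine mul_le_mul_of_nonneg_right ?_ (sq_nonneg _)
          have h1 := hηL x x'
          have h3 : |η x - η x'| ≤ (ρ : ℝ)⁻¹ * (P.L : ℝ) ^ k := by
            refine h1.trans ?_
            rw [div_eq_inv_mul]
            exact mul_le_mul_of_nonneg_left (by exact_mod_cast hd) (inv_nonneg.2 hρ0.le)
          calc (η x - η x') ^ 2 = |η x - η x'| ^ 2 := (sq_abs _).symm
            _ ≤ ((ρ : ℝ)⁻¹ * (P.L : ℝ) ^ k) ^ 2 := pow_le_pow_left₀ (abs_nonneg _) h3 2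
            _ = (ρ : ℝ)⁻¹ ^ 2 * ((P.L : ℝ) ^ k) ^ 2 := by ring
        · -- both `x` and `x′` are outside the ball of radius `2ρ`: the tent vanishes at both
          rw [if_neg hxb, mul_zero]
          have hx2 : 2 * ρ ≤ supDist y₀ x := by rw [mem_ball] at hxb; omega
          have hx'2 : 2 * ρ ≤ supDist y₀ x' := by
            rw [mem_ball] at hxb
            have h1 := supDist_triangle y₀ x' x
            rw [supDist_comm x' x] at h1
            omega
          rw [hηzero x hx2, hηzero x' hx'2, sub_self]
          simp
      calc ∑ x' ∈ blockK k y, (η x - η x') ^ 2 * ‖φ x‖ ^ 2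
          ≤ ∑ _x' ∈ blockK k y, ((ρ : ℝ)⁻¹ ^ 2 * ((P.L : ℝ) ^ k) ^ 2) * (if x ∈ ball y₀ (2 * ρ + P.L ^ k) then ‖φ x‖ ^ 2 else 0) :=
            Finset.sum_le_sum hterm
        _ = _ := by rw [Finset.sum_const, card_blockK k hk y, nsmul_eq_mul, Nat.cast_pow]; ring
    calc (1 / 2) * (((P.L : ℝ) ^ (k * P.d))⁻¹) ^ 2 *
          ∑ y : Balaban1983to89.Site P (j + k), ∑ x ∈ blockK k y, ∑ x' ∈ blockK k y, (η x - η x') ^ 2 * (‖φ x‖ * ‖φ x'‖)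
        ≤ (1 / 2) * (((P.L : ℝ) ^ (k * P.d))⁻¹) ^ 2 *
          ∑ y : Balaban1983to89.Site P (j + k), ∑ x ∈ blockK k y, (P.L : ℝ) ^ (k * P.d) * ((ρ : ℝ)⁻¹ ^ 2 * ((P.L : ℝ) ^ k) ^ 2) *
            (if x ∈ ball y₀ (2 * ρ + P.L ^ k) then ‖φ x‖ ^ 2 else 0) :=
          mul_le_mul_of_nonneg_left (Finset.sum_le_sum fun y _ => hy y) (by positivity)
      _ = (1 / 2) * ((P.L : ℝ) ^ (k * P.d))⁻¹ * ((ρ : ℝ)⁻¹ ^ 2 * ((P.L : ℝ) ^ k) ^ 2) * ∑ x ∈ ball y₀ (2 * ρ + P.L ^ k), ‖φ x‖ ^ 2 := by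
          rw [sum_blockK_eq_sum (fun x => (P.L : ℝ) ^ (k * P.d) * ((ρ : ℝ)⁻¹ ^ 2 * ((P.L : ℝ) ^ k) ^ 2) *
            (if x ∈ ball y₀ (2 * ρ + P.L ^ k) then ‖φ x‖ ^ 2 else 0)), ← Finset.mul_sum, ← Finset.sum_filter,
            Finset.filter_mem_eq_inter, Finset.univ_inter]
          field_simp
  -- assemble
  have h := hLHS.trans ((le_add_of_nonneg_right (mul_nonneg ha (sq_nonneg _))).trans (hmain.trans (add_le_add hD
    (mul_le_mul_of_nonneg_left hQ ha))))
  refine h.trans (le_of_eq ?_)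
  ring

/-! ## §5 THE AGMON BOUND: exponential weights times a cutoff of the boundary layer -/

/-- kernel: `ab ≤ ½b² + ½a²`. [folklore] -/
private theorem mul_le_half_sq_add (a b : ℝ) : a * b ≤ (1 / 2) * b ^ 2 + (1 / 2) * a ^ 2 := by
  nlinarith [sq_nonneg (a - b)]

/-- kernel: the oscillation of the weight `ω = ηe^{g}` over a pair of sites: if `|g₁ − g₂| ≤ s` (`s ≥ 0`) then
`(η₁e^{g₁} − η₂e^{g₂})² ≤ 2e^{2s}((η₁ − η₂)²e^{2g₁} + s²(η₁e^{g₁})²)` (split `η₁e^{g₁} − η₂e^{g₂} = (η₁ − η₂)e^{g₂} + η₁(e^{g₁} − e^{g₂})`,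
mean value theorem for the second piece). [folklore] -/
private theorem osc_weight_sq_le (η₁ η₂ : ℝ) {g₁ g₂ s : ℝ} (hgs : |g₁ - g₂| ≤ s) :
    (η₁ * Real.exp g₁ - η₂ * Real.exp g₂) ^ 2 ≤
      2 * Real.exp (2 * s) * ((η₁ - η₂) ^ 2 * Real.exp (2 * g₁) + s ^ 2 * (η₁ * Real.exp g₁) ^ 2) := by
  have hex0 := Real.exp_pos g₁
  have hex0' := Real.exp_pos g₂
  have hes : Real.exp g₂ ≤ Real.exp s * Real.exp g₁ := by
    rw [← Real.exp_add]; refine Real.exp_le_exp.2 ?_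
    have := (abs_le.1 hgs).1; linarith
  set p₁ : ℝ := (η₁ - η₂) * Real.exp g₂ with hp₁
  set p₂ : ℝ := η₁ * (Real.exp g₁ - Real.exp g₂) with hp₂
  have hdec : η₁ * Real.exp g₁ - η₂ * Real.exp g₂ = p₁ + p₂ := by rw [hp₁, hp₂]; ring
  have hsq : (p₁ + p₂) ^ 2 ≤ 2 * p₁ ^ 2 + 2 * p₂ ^ 2 := by nlinarith [sq_nonneg (p₁ - p₂)]
  have h3 : Real.exp g₂ ^ 2 ≤ Real.exp (2 * s) * Real.exp (2 * g₁) := by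
    have e1 : Real.exp (2 * s) * Real.exp (2 * g₁) = (Real.exp s * Real.exp g₁) ^ 2 := by
      rw [mul_pow, ← Real.exp_nat_mul, ← Real.exp_nat_mul]; push_cast; rfl
    rw [e1]; exact pow_le_pow_left₀ hex0'.le hes 2
  have hP₁ : p₁ ^ 2 ≤ (η₁ - η₂) ^ 2 * (Real.exp (2 * s) * Real.exp (2 * g₁)) := by
    rw [hp₁, mul_pow]; exact mul_le_mul_of_nonneg_left h3 (sq_nonneg _)
  have h1 : (Real.exp g₁ - Real.exp g₂) ^ 2 ≤ s ^ 2 * Real.exp s * (Real.exp g₁ * Real.exp g₂) :=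
    sq_exp_sub_exp_le_of_abs_le hgs
  have h2 : (Real.exp g₁ - Real.exp g₂) ^ 2 ≤ s ^ 2 * Real.exp (2 * s) * Real.exp g₁ ^ 2 := by
    refine h1.trans ?_
    have h4 : Real.exp g₁ * Real.exp g₂ ≤ Real.exp s * Real.exp g₁ ^ 2 :=
      calc Real.exp g₁ * Real.exp g₂ ≤ Real.exp g₁ * (Real.exp s * Real.exp g₁) := mul_le_mul_of_nonneg_left hes hex0.le
        _ = Real.exp s * Real.exp g₁ ^ 2 := by ring
    have h5 : Real.exp s * Real.exp s = Real.exp (2 * s) := by rw [← Real.exp_add, two_mul]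
    calc s ^ 2 * Real.exp s * (Real.exp g₁ * Real.exp g₂) ≤ s ^ 2 * Real.exp s * (Real.exp s * Real.exp g₁ ^ 2) :=
          mul_le_mul_of_nonneg_left h4 (by positivity)
      _ = s ^ 2 * Real.exp (2 * s) * Real.exp g₁ ^ 2 := by rw [← h5]; ring
  have hP₂ : p₂ ^ 2 ≤ η₁ ^ 2 * (s ^ 2 * Real.exp (2 * s) * Real.exp g₁ ^ 2) := by
    rw [hp₂, mul_pow]; exact mul_le_mul_of_nonneg_left h2 (sq_nonneg _)
  calc (η₁ * Real.exp g₁ - η₂ * Real.exp g₂) ^ 2 = (p₁ + p₂) ^ 2 := by rw [hdec]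
    _ ≤ 2 * p₁ ^ 2 + 2 * p₂ ^ 2 := hsq
    _ ≤ 2 * ((η₁ - η₂) ^ 2 * (Real.exp (2 * s) * Real.exp (2 * g₁))) + 2 * (η₁ ^ 2 * (s ^ 2 * Real.exp (2 * s) * Real.exp g₁ ^ 2)) :=
        add_le_add (mul_le_mul_of_nonneg_left hP₁ zero_le_two) (mul_le_mul_of_nonneg_left hP₂ zero_le_two)
    _ = 2 * Real.exp (2 * s) * ((η₁ - η₂) ^ 2 * Real.exp (2 * g₁) + s ^ 2 * (η₁ * Real.exp g₁) ^ 2) := by ring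

/-- kernel: linear bookkeeping for the bond sum, `Σ_zΣ_μ p(q(A_z + B_{zμ}) + r(C_z + D_{zμ}))` split into four double sums. [folklore] -/
private theorem sum_sum_split {ι κ : Type*} [Fintype ι] [Fintype κ] (p q r : ℝ) (A C : ι → ℝ) (B D : ι → κ → ℝ) :
    ∑ z, ∑ μ, p * (q * (A z + B z μ) + r * (C z + D z μ)) =
      p * (q * ((∑ z, ∑ _μ : κ, A z) + ∑ z, ∑ μ, B z μ) + r * ((∑ z, ∑ _μ : κ, C z) + ∑ z, ∑ μ, D z μ)) := by
  simp only [mul_add, Finset.mul_sum, Finset.sum_add_distrib]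

/-- kernel: linear bookkeeping for the block sum, `Σ_x p(p′(qA_x + rC_x)) = pp′(qΣA + rΣC)`. [folklore] -/
private theorem sum_split {ι : Type*} [Fintype ι] (p p' q r : ℝ) (A C : ι → ℝ) :
    ∑ x, p * (p' * (q * A x + r * C x)) = p * p' * (q * ∑ x, A x + r * ∑ x, C x) := by
  simp only [mul_add, Finset.mul_sum, Finset.sum_add_distrib, mul_assoc]

/-- kernel: the per-bond estimate of the Agmon bound (notation of `agmon_harmonic`, `ω = ηe^{g}`): the oscillation of `ω` over a bond, split
symmetrically between its two ends, costs `e^{2t}ℓ⁻²` on the transition set `S` plus `e^{2t}(t/L^k)²ω²`.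
[cite: BalabanImbrieJaffe1985, (4.6.3) p.313, (7.3.1) p.326] -/
private theorem agmon_bond_le {k : ℕ} (φ : FineSp P j) (ω η g : Balaban1983to89.Site P j → ℝ) (hω : ∀ x, ω x = η x * Real.exp (g x))
    {ℓ t : ℝ} (hℓ : 0 < ℓ) (ht : 0 ≤ t) (hηL : ∀ x x', |η x - η x'| ≤ (supDist x x' : ℝ) / ℓ)
    (hg : ∀ x x', |g x - g x'| ≤ t * (supDist x x' : ℝ) / (P.L : ℝ) ^ k)
    (S : Finset (Balaban1983to89.Site P j)) (hS : ∀ x x', supDist x x' ≤ P.L ^ k → η x ≠ η x' → x ∈ S)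
    (z : Balaban1983to89.Site P j) (μ : Fin P.d) :
    (ω (z.shift μ) - ω z) ^ 2 * (‖φ (z.shift μ)‖ * ‖φ z‖) ≤
      Real.exp (2 * t) * (ℓ⁻¹ ^ 2 * ((if z ∈ S then Real.exp (2 * g z) * ‖φ z‖ ^ 2 else 0) +
          (if z.shift μ ∈ S then Real.exp (2 * g (z.shift μ)) * ‖φ (z.shift μ)‖ ^ 2 else 0)) +
        (t / (P.L : ℝ) ^ k) ^ 2 * (ω z ^ 2 * ‖φ z‖ ^ 2 + ω (z.shift μ) ^ 2 * ‖φ (z.shift μ)‖ ^ 2)) := by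
  set n : ℝ := (P.L : ℝ) ^ k with hndef
  set E : ℝ := Real.exp (2 * t) with hEdef
  have hn : 0 < n := pow_pos P.cast_L_pos _
  have hn1 : 1 ≤ n := one_le_pow₀ (by exact_mod_cast P.L_pos)
  have htn : t / n ≤ t := div_le_self ht hn1
  have hEn : Real.exp (2 * (t / n)) ≤ E := Real.exp_le_exp.2 (by linarith)
  have hL1 : 1 ≤ P.L ^ k := Nat.one_le_pow _ _ P.L_pos
  have hd1 : supDist z (z.shift μ) ≤ 1 := BIJ85TorusTentCutoff.supDist_shift_le_one' z μ
  have hgb : |g z - g (z.shift μ)| ≤ t / n := by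
    refine (hg z (z.shift μ)).trans (div_le_div_of_nonneg_right ?_ hn.le)
    have : (supDist z (z.shift μ) : ℝ) ≤ 1 := by exact_mod_cast hd1
    exact mul_le_of_le_one_right ht this
  have hgb' : |g (z.shift μ) - g z| ≤ t / n := by rwa [abs_sub_comm]
  -- the two oscillation bounds, centred at `z` and at `z + e_μ`
  have o1 := osc_weight_sq_le (η z) (η (z.shift μ)) hgb
  have o2 := osc_weight_sq_le (η (z.shift μ)) (η z) hgb'
  rw [← hω z, ← hω (z.shift μ)] at o1 o2
  -- the `η`-oscillation lives on `S`
  have hI : ∀ w : Balaban1983to89.Site P j, (0 : ℝ) ≤ (if w ∈ S then (1 : ℝ) else 0) ∧ (if w ∈ S then (1 : ℝ) else 0) ≤ 1 :=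
    fun w => by constructor <;> split_ifs <;> norm_num
  have hΔ : (η z - η (z.shift μ)) ^ 2 ≤ ℓ⁻¹ ^ 2 * (if z ∈ S then 1 else 0) * (if z.shift μ ∈ S then 1 else 0) := by
    by_cases hne : η z = η (z.shift μ)
    · rw [hne, sub_self, zero_pow two_ne_zero]
      exact mul_nonneg (mul_nonneg (sq_nonneg _) (hI z).1) (hI _).1
    · have h1 : z ∈ S := hS z (z.shift μ) (hd1.trans hL1) hne
      have h2 : z.shift μ ∈ S := hS (z.shift μ) z (by rw [supDist_comm]; exact hd1.trans hL1) (Ne.symm hne)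
      rw [if_pos h1, if_pos h2, mul_one, mul_one]
      have h3 : |η z - η (z.shift μ)| ≤ ℓ⁻¹ := (hηL z (z.shift μ)).trans (by
        rw [div_le_iff₀ hℓ, inv_mul_cancel₀ hℓ.ne']; exact_mod_cast hd1)
      calc (η z - η (z.shift μ)) ^ 2 = |η z - η (z.shift μ)| ^ 2 := (sq_abs _).symm
        _ ≤ ℓ⁻¹ ^ 2 := pow_le_pow_left₀ (abs_nonneg _) h3 2
  have hΔz : (η z - η (z.shift μ)) ^ 2 ≤ ℓ⁻¹ ^ 2 * (if z ∈ S then 1 else 0) :=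
    hΔ.trans (mul_le_of_le_one_right (mul_nonneg (sq_nonneg _) (hI z).1) (hI _).2)
  have hΔz' : (η (z.shift μ) - η z) ^ 2 ≤ ℓ⁻¹ ^ 2 * (if z.shift μ ∈ S then 1 else 0) := by
    rw [show (η (z.shift μ) - η z) ^ 2 = (η z - η (z.shift μ)) ^ 2 by ring]
    refine hΔ.trans ?_
    rw [mul_assoc, mul_comm (if z ∈ S then (1:ℝ) else 0), ← mul_assoc]
    exact mul_le_of_le_one_right (mul_nonneg (sq_nonneg _) (hI _).1) (hI z).2
  -- `(ω₊−ω₋)²·‖φ₊‖‖φ₋‖ ≤ ½(ω₋−ω₊)²‖φ₋‖² + ½(ω₊−ω₋)²‖φ₊‖²`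
  have hsplit : (ω (z.shift μ) - ω z) ^ 2 * (‖φ (z.shift μ)‖ * ‖φ z‖) ≤
      (1 / 2) * ‖φ z‖ ^ 2 * (ω z - ω (z.shift μ)) ^ 2 + (1 / 2) * ‖φ (z.shift μ)‖ ^ 2 * (ω (z.shift μ) - ω z) ^ 2 := by
    have e : (ω z - ω (z.shift μ)) ^ 2 = (ω (z.shift μ) - ω z) ^ 2 := by ring
    rw [e]
    have hp := mul_le_half_sq_add ‖φ (z.shift μ)‖ ‖φ z‖
    have h := mul_le_mul_of_nonneg_left hp (sq_nonneg (ω (z.shift μ) - ω z))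
    refine h.trans (le_of_eq ?_); ring
  refine hsplit.trans ?_
  have h1 : (ω z - ω (z.shift μ)) ^ 2 ≤ 2 * E * (ℓ⁻¹ ^ 2 * (if z ∈ S then 1 else 0) * Real.exp (2 * g z) + (t / n) ^ 2 * ω z ^ 2) := by
    refine o1.trans ?_
    have hi : (η z - η (z.shift μ)) ^ 2 * Real.exp (2 * g z) ≤ ℓ⁻¹ ^ 2 * (if z ∈ S then 1 else 0) * Real.exp (2 * g z) :=
      mul_le_mul_of_nonneg_right hΔz (Real.exp_pos _).le
    have hA : 0 ≤ ℓ⁻¹ ^ 2 * (if z ∈ S then 1 else 0) * Real.exp (2 * g z) + (t / n) ^ 2 * ω z ^ 2 :=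
      add_nonneg (mul_nonneg (mul_nonneg (sq_nonneg _) (hI z).1) (Real.exp_pos _).le) (mul_nonneg (sq_nonneg _) (sq_nonneg _))
    exact mul_le_mul (mul_le_mul_of_nonneg_left hEn zero_le_two) (add_le_add hi le_rfl) (by positivity) (by positivity)
  have h2 : (ω (z.shift μ) - ω z) ^ 2 ≤
      2 * E * (ℓ⁻¹ ^ 2 * (if z.shift μ ∈ S then 1 else 0) * Real.exp (2 * g (z.shift μ)) + (t / n) ^ 2 * ω (z.shift μ) ^ 2) := by
    refine o2.trans ?_
    have hi : (η (z.shift μ) - η z) ^ 2 * Real.exp (2 * g (z.shift μ)) ≤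
        ℓ⁻¹ ^ 2 * (if z.shift μ ∈ S then 1 else 0) * Real.exp (2 * g (z.shift μ)) :=
      mul_le_mul_of_nonneg_right hΔz' (Real.exp_pos _).le
    exact mul_le_mul (mul_le_mul_of_nonneg_left hEn zero_le_two) (add_le_add hi le_rfl) (by positivity) (by positivity)
  have half1 : (1 / 2) * ‖φ z‖ ^ 2 * (ω z - ω (z.shift μ)) ^ 2 ≤
      E * (ℓ⁻¹ ^ 2 * (if z ∈ S then Real.exp (2 * g z) * ‖φ z‖ ^ 2 else 0) + (t / n) ^ 2 * (ω z ^ 2 * ‖φ z‖ ^ 2)) := by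
    have h3 := mul_le_mul_of_nonneg_left h1 (by positivity : (0 : ℝ) ≤ (1 / 2) * ‖φ z‖ ^ 2)
    refine h3.trans (le_of_eq ?_)
    by_cases hzS : z ∈ S
    · simp only [if_pos hzS]; ring
    · simp only [if_neg hzS]; ring
  have half2 : (1 / 2) * ‖φ (z.shift μ)‖ ^ 2 * (ω (z.shift μ) - ω z) ^ 2 ≤
      E * (ℓ⁻¹ ^ 2 * (if z.shift μ ∈ S then Real.exp (2 * g (z.shift μ)) * ‖φ (z.shift μ)‖ ^ 2 else 0) +
        (t / n) ^ 2 * (ω (z.shift μ) ^ 2 * ‖φ (z.shift μ)‖ ^ 2)) := by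
    have h3 := mul_le_mul_of_nonneg_left h2 (by positivity : (0 : ℝ) ≤ (1 / 2) * ‖φ (z.shift μ)‖ ^ 2)
    refine h3.trans (le_of_eq ?_)
    by_cases hzS : z.shift μ ∈ S
    · simp only [if_pos hzS]; ring
    · simp only [if_neg hzS]; ring
  have e : E * (ℓ⁻¹ ^ 2 * ((if z ∈ S then Real.exp (2 * g z) * ‖φ z‖ ^ 2 else 0) +
          (if z.shift μ ∈ S then Real.exp (2 * g (z.shift μ)) * ‖φ (z.shift μ)‖ ^ 2 else 0)) +
        (t / n) ^ 2 * (ω z ^ 2 * ‖φ z‖ ^ 2 + ω (z.shift μ) ^ 2 * ‖φ (z.shift μ)‖ ^ 2)) =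
      E * (ℓ⁻¹ ^ 2 * (if z ∈ S then Real.exp (2 * g z) * ‖φ z‖ ^ 2 else 0) + (t / n) ^ 2 * (ω z ^ 2 * ‖φ z‖ ^ 2)) +
      E * (ℓ⁻¹ ^ 2 * (if z.shift μ ∈ S then Real.exp (2 * g (z.shift μ)) * ‖φ (z.shift μ)‖ ^ 2 else 0) +
        (t / n) ^ 2 * (ω (z.shift μ) ^ 2 * ‖φ (z.shift μ)‖ ^ 2)) := by ring
  rw [e]; exact add_le_add half1 half2

/-- kernel: the per-block estimate of the Agmon bound (notation of `agmon_harmonic`, `ω = ηe^{g}`, `N = L^{kd}`, `n = L^k`): the symmetrised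
oscillation of `ω` over a `k`-block costs `N·2e^{2t}(ℓ⁻²n²·[x ∈ S]e^{2g} + t²ω²)‖φ‖²` per site.
[cite: BalabanImbrieJaffe1985, (4.6.1) p.313, (7.3.1) p.326] -/
private theorem agmon_block_le {k : ℕ} (hk : j + k ≤ P.m + P.K) (φ : FineSp P j) (ω η g : Balaban1983to89.Site P j → ℝ)
    (hω : ∀ x, ω x = η x * Real.exp (g x)) {ℓ t : ℝ} (hℓ : 0 < ℓ) (ht : 0 ≤ t)
    (hηL : ∀ x x', |η x - η x'| ≤ (supDist x x' : ℝ) / ℓ) (hg : ∀ x x', |g x - g x'| ≤ t * (supDist x x' : ℝ) / (P.L : ℝ) ^ k)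
    (S : Finset (Balaban1983to89.Site P j)) (hS : ∀ x x', supDist x x' ≤ P.L ^ k → η x ≠ η x' → x ∈ S)
    (y : Balaban1983to89.Site P (j + k)) :
    ∑ x ∈ blockK k y, ∑ x' ∈ blockK k y, (ω x - ω x') ^ 2 * (‖φ x‖ * ‖φ x'‖) ≤
      ∑ x ∈ blockK k y, (P.L : ℝ) ^ (k * P.d) * (2 * Real.exp (2 * t) *
        (ℓ⁻¹ ^ 2 * ((P.L : ℝ) ^ k) ^ 2 * (if x ∈ S then Real.exp (2 * g x) * ‖φ x‖ ^ 2 else 0) + t ^ 2 * (ω x ^ 2 * ‖φ x‖ ^ 2))) := by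
  set n : ℝ := (P.L : ℝ) ^ k with hndef
  set E : ℝ := Real.exp (2 * t) with hEdef
  have hn : 0 < n := pow_pos P.cast_L_pos _
  refine (double_sum_mul_le_sq _ (fun x x' => (ω x - ω x') ^ 2) (fun x x' => by ring) (fun x x' => sq_nonneg _) _).trans ?_
  refine Finset.sum_le_sum fun x hx => ?_
  have hterm : ∀ x' ∈ blockK k y, (ω x - ω x') ^ 2 * ‖φ x‖ ^ 2 ≤
      2 * E * (ℓ⁻¹ ^ 2 * n ^ 2 * (if x ∈ S then Real.exp (2 * g x) * ‖φ x‖ ^ 2 else 0) + t ^ 2 * (ω x ^ 2 * ‖φ x‖ ^ 2)) := by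
    intro x' hx'
    have hd : supDist x x' ≤ P.L ^ k := supDist_le_of_mem_blockK hk hx hx'
    have hgs : |g x - g x'| ≤ t := by
      refine (hg x x').trans ?_
      rw [div_le_iff₀ hn]; have : (supDist x x' : ℝ) ≤ n := by rw [hndef]; exact_mod_cast hd
      exact mul_le_mul_of_nonneg_left this ht
    have o := osc_weight_sq_le (η x) (η x') hgs
    rw [← hω x, ← hω x'] at o
    have hI : (0 : ℝ) ≤ (if x ∈ S then (1 : ℝ) else 0) := by split_ifs <;> norm_num
    have hΔ : (η x - η x') ^ 2 ≤ ℓ⁻¹ ^ 2 * n ^ 2 * (if x ∈ S then 1 else 0) := by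
      by_cases hne : η x = η x'
      · rw [hne, sub_self, zero_pow two_ne_zero]; exact mul_nonneg (by positivity) hI
      · rw [if_pos (hS x x' hd hne), mul_one]
        have h3 : |η x - η x'| ≤ ℓ⁻¹ * n := (hηL x x').trans (by
          rw [div_eq_inv_mul]; refine mul_le_mul_of_nonneg_left ?_ (inv_nonneg.2 hℓ.le)
          rw [hndef]; exact_mod_cast hd)
        calc (η x - η x') ^ 2 = |η x - η x'| ^ 2 := (sq_abs _).symm
          _ ≤ (ℓ⁻¹ * n) ^ 2 := pow_le_pow_left₀ (abs_nonneg _) h3 2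
          _ = ℓ⁻¹ ^ 2 * n ^ 2 := by ring
    have hη2 : (η x - η x') ^ 2 * Real.exp (2 * g x) ≤ ℓ⁻¹ ^ 2 * n ^ 2 * (if x ∈ S then 1 else 0) * Real.exp (2 * g x) :=
      mul_le_mul_of_nonneg_right hΔ (Real.exp_pos _).le
    have h1 : (ω x - ω x') ^ 2 ≤ 2 * E * (ℓ⁻¹ ^ 2 * n ^ 2 * (if x ∈ S then 1 else 0) * Real.exp (2 * g x) + t ^ 2 * ω x ^ 2) :=
      o.trans (mul_le_mul_of_nonneg_left (add_le_add hη2 le_rfl) (by positivity))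
    have h3 := mul_le_mul_of_nonneg_right h1 (sq_nonneg ‖φ x‖)
    refine h3.trans (le_of_eq ?_)
    by_cases hxS : x ∈ S
    · simp only [if_pos hxS]; ring
    · simp only [if_neg hxS]; ring
  calc ∑ x' ∈ blockK k y, (ω x - ω x') ^ 2 * ‖φ x‖ ^ 2
      ≤ ∑ _x' ∈ blockK k y, (2 * E * (ℓ⁻¹ ^ 2 * n ^ 2 * (if x ∈ S then Real.exp (2 * g x) * ‖φ x‖ ^ 2 else 0) +
          t ^ 2 * (ω x ^ 2 * ‖φ x‖ ^ 2))) := Finset.sum_le_sum hterm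
    _ = _ := by rw [Finset.sum_const, card_blockK k hk y, nsmul_eq_mul, Nat.cast_pow]

/-- **THE CACCIOPPOLI–AGMON `ℓ²` BOUND FOR LOCALLY `T`-HARMONIC FUNCTIONS** (`T = D_u^*D_u + aQ_k(u)^*Q_k(u)`, `a > 0`, any real `c`,
`j + k ≤ m + K`, block-scale plaquette smallness `2d³(L^{2k}θ)² ≤ 1`).  Data: a cutoff `η` with `0 ≤ η ≤ 1`, `|η(x) − η(x′)| ≤ |x − x′|_∞/ℓ`,
a tilt `g` with `|g(x) − g(x′)| ≤ t|x − x′|_∞/L^k` (`t ≥ 0`), a finite set `S` containing every site at which `η` is not locally constant at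
the block scale (`|x − x′|_∞ ≤ L^k`, `η(x) ≠ η(x′)` ⟹ `x ∈ S`), and `(Tφ)(x) = 0` wherever `η(x) ≠ 0`.  If the tilt is small,
`(2dc²(t/L^k)² + aN⁻¹t²)e^{2t} ≤ m₀/2` (`m₀ = min(a/2, c²N/(4n²))/N`, `n = L^k`, `N = L^{kd}`), then with `ω = ηe^{g}`:
`(m₀/2)·Σ_xω(x)²‖φ(x)‖² ≤ e^{2t}ℓ⁻²(2dc² + aN⁻¹n²)·Σ_{x∈S}e^{2g(x)}‖φ(x)‖²` — the exponentially weighted mass of a harmonic function is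
controlled by its weighted mass ON THE TRANSITION LAYER of the cutoff (IMS with `ω = ηe^{g}`: the `e^{g}`-oscillation is absorbed by the
coercivity, the `η`-oscillation lives on `S`). [cite: BalabanImbrieJaffe1985, (4.6.2) p.313, (7.3.1) p.326]
[cite: Balaban1983RegularityDecay, Theorem p.573 (1.11)–(1.12)] -/
theorem agmon_harmonic {k : ℕ} (hk : j + k ≤ P.m + P.K) (c : ℝ) {a : ℝ} (ha : 0 < a) (U : GaugeField P j U1) {θ : ℝ}
    (hθ : ∀ (x : Balaban1983to89.Site P j) (μ ν : Fin P.d), ‖plaqC U x μ ν - 1‖ ≤ θ)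
    (hsmall : 2 * (P.d : ℝ) ^ 3 * (((P.L : ℝ) ^ k) ^ 2 * θ) ^ 2 ≤ 1) (φ : FineSp P j)
    (η g : Balaban1983to89.Site P j → ℝ) {ℓ t : ℝ} (hℓ : 0 < ℓ) (ht : 0 ≤ t)
    (hηL : ∀ x x', |η x - η x'| ≤ (supDist x x' : ℝ) / ℓ)
    (hg : ∀ x x', |g x - g x'| ≤ t * (supDist x x' : ℝ) / (P.L : ℝ) ^ k)
    (S : Finset (Balaban1983to89.Site P j)) (hS : ∀ x x', supDist x x' ≤ P.L ^ k → η x ≠ η x' → x ∈ S)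
    (hT : ∀ x, η x ≠ 0 → opT (Dlin c U) (QlinK U k) a φ x = 0)
    (hκ : (2 * P.d * c ^ 2 * (t / (P.L : ℝ) ^ k) ^ 2 + a * ((P.L : ℝ) ^ (k * P.d))⁻¹ * t ^ 2) * Real.exp (2 * t)
      ≤ min (a / 2) (c ^ 2 * (P.L : ℝ) ^ (k * P.d) / (4 * ((P.L : ℝ) ^ k) ^ 2)) / (P.L : ℝ) ^ (k * P.d) / 2) :
    min (a / 2) (c ^ 2 * (P.L : ℝ) ^ (k * P.d) / (4 * ((P.L : ℝ) ^ k) ^ 2)) / (P.L : ℝ) ^ (k * P.d) / 2 *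
        ∑ x : Balaban1983to89.Site P j, (η x * Real.exp (g x)) ^ 2 * ‖φ x‖ ^ 2
      ≤ Real.exp (2 * t) * ℓ⁻¹ ^ 2 * (2 * P.d * c ^ 2 + a * ((P.L : ℝ) ^ (k * P.d))⁻¹ * ((P.L : ℝ) ^ k) ^ 2) *
          ∑ x ∈ S, Real.exp (2 * g x) * ‖φ x‖ ^ 2 := by
  set ω : Balaban1983to89.Site P j → ℝ := fun x => η x * Real.exp (g x) with hωdef
  have hω : ∀ x, ω x = η x * Real.exp (g x) := fun x => by rw [hωdef]
  set n : ℝ := (P.L : ℝ) ^ k with hndef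
  set N : ℝ := (P.L : ℝ) ^ (k * P.d) with hNdef
  set m₀ : ℝ := min (a / 2) (c ^ 2 * N / (4 * n ^ 2)) / N with hm₀
  set E : ℝ := Real.exp (2 * t) with hEdef
  set WS : ℝ := ∑ x ∈ S, Real.exp (2 * g x) * ‖φ x‖ ^ 2 with hWSdef
  have hW' : ∑ x : Balaban1983to89.Site P j, (η x * Real.exp (g x)) ^ 2 * ‖φ x‖ ^ 2 = ∑ x, ω x ^ 2 * ‖φ x‖ ^ 2 :=
    Finset.sum_congr rfl fun x _ => by rw [hω]
  rw [hW']
  set W : ℝ := ∑ x : Balaban1983to89.Site P j, ω x ^ 2 * ‖φ x‖ ^ 2 with hWdef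
  have hN : 0 < N := pow_pos P.cast_L_pos _
  -- harmonic hypothesis for `ω`, and §2
  have hT' : ∀ x, ω x ≠ 0 → opT (Dlin c U) (QlinK U k) a φ x = 0 := fun x hx => hT x fun h => hx (by rw [hω, h, zero_mul])
  have hmain := coercive_wmul_le_of_harmonic hk c ha U hθ hsmall ω φ hT'
  have hWeq : ‖wmul ω φ‖ ^ 2 = W := by rw [norm_wmul_sq]; exact Finset.sum_congr rfl fun x _ => by ring
  rw [hWeq] at hmain
  -- (1) the bond defect
  have hD : c ^ 2 * ∑ b : PBond P j, (ω b.tgt - ω b.src) ^ 2 * (‖φ b.tgt‖ * ‖φ b.src‖) ≤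
      c ^ 2 * (2 * E * (ℓ⁻¹ ^ 2 * (P.d * WS) + (t / n) ^ 2 * (P.d * W))) := by
    refine mul_le_mul_of_nonneg_left ?_ (sq_nonneg _)
    rw [sum_bond_eq]
    calc ∑ z, ∑ μ : Fin P.d, (ω (PBond.tgt ⟨z, μ⟩) - ω (PBond.src ⟨z, μ⟩)) ^ 2 * (‖φ (PBond.tgt ⟨z, μ⟩)‖ * ‖φ (PBond.src ⟨z, μ⟩)‖)
        ≤ ∑ z, ∑ μ : Fin P.d, (E * (ℓ⁻¹ ^ 2 * ((if z ∈ S then Real.exp (2 * g z) * ‖φ z‖ ^ 2 else 0) +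
              (if z.shift μ ∈ S then Real.exp (2 * g (z.shift μ)) * ‖φ (z.shift μ)‖ ^ 2 else 0)) +
            (t / n) ^ 2 * (ω z ^ 2 * ‖φ z‖ ^ 2 + ω (z.shift μ) ^ 2 * ‖φ (z.shift μ)‖ ^ 2))) :=
          Finset.sum_le_sum fun z _ => Finset.sum_le_sum fun μ _ => agmon_bond_le φ ω η g hω hℓ ht hηL hg S hS z μ
      _ = E * (ℓ⁻¹ ^ 2 * (P.d * WS + P.d * WS) + (t / n) ^ 2 * (P.d * W + P.d * W)) := by
          rw [sum_sum_split E (ℓ⁻¹ ^ 2) ((t / n) ^ 2) (fun z => if z ∈ S then Real.exp (2 * g z) * ‖φ z‖ ^ 2 else 0)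
            (fun z => ω z ^ 2 * ‖φ z‖ ^ 2) (fun z μ => if z.shift μ ∈ S then Real.exp (2 * g (z.shift μ)) * ‖φ (z.shift μ)‖ ^ 2 else 0)
            (fun z μ => ω (z.shift μ) ^ 2 * ‖φ (z.shift μ)‖ ^ 2), hWSdef, hWdef,
            sum_sum_indicator S (fun x => Real.exp (2 * g x) * ‖φ x‖ ^ 2),
            sum_sum_shift_indicator S (fun x => Real.exp (2 * g x) * ‖φ x‖ ^ 2),
            sum_sum_dir (fun x => ω x ^ 2 * ‖φ x‖ ^ 2), sum_sum_shift_dir (fun x => ω x ^ 2 * ‖φ x‖ ^ 2)]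
      _ = 2 * E * (ℓ⁻¹ ^ 2 * (P.d * WS) + (t / n) ^ 2 * (P.d * W)) := by ring
  -- (2) the block defect
  have hQ : (1 / 2) * (N⁻¹) ^ 2 *
        ∑ y : Balaban1983to89.Site P (j + k), ∑ x ∈ blockK k y, ∑ x' ∈ blockK k y, (ω x - ω x') ^ 2 * (‖φ x‖ * ‖φ x'‖) ≤
      N⁻¹ * E * (ℓ⁻¹ ^ 2 * n ^ 2 * WS + t ^ 2 * W) := by
    calc (1 / 2) * (N⁻¹) ^ 2 *
          ∑ y : Balaban1983to89.Site P (j + k), ∑ x ∈ blockK k y, ∑ x' ∈ blockK k y, (ω x - ω x') ^ 2 * (‖φ x‖ * ‖φ x'‖)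
        ≤ (1 / 2) * (N⁻¹) ^ 2 * ∑ y : Balaban1983to89.Site P (j + k), ∑ x ∈ blockK k y,
            N * (2 * E * (ℓ⁻¹ ^ 2 * n ^ 2 * (if x ∈ S then Real.exp (2 * g x) * ‖φ x‖ ^ 2 else 0) + t ^ 2 * (ω x ^ 2 * ‖φ x‖ ^ 2))) :=
          mul_le_mul_of_nonneg_left (Finset.sum_le_sum fun y _ => agmon_block_le hk φ ω η g hω hℓ ht hηL hg S hS y) (by positivity)
      _ = N⁻¹ * E * (ℓ⁻¹ ^ 2 * n ^ 2 * WS + t ^ 2 * W) := by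
          rw [sum_blockK_eq_sum (fun x => N * (2 * E * (ℓ⁻¹ ^ 2 * n ^ 2 * (if x ∈ S then Real.exp (2 * g x) * ‖φ x‖ ^ 2 else 0) +
            t ^ 2 * (ω x ^ 2 * ‖φ x‖ ^ 2)))), hWSdef, hWdef,
            sum_split N (2 * E) (ℓ⁻¹ ^ 2 * n ^ 2) (t ^ 2) (fun x => if x ∈ S then Real.exp (2 * g x) * ‖φ x‖ ^ 2 else 0)
              (fun x => ω x ^ 2 * ‖φ x‖ ^ 2), ← Finset.sum_filter, Finset.filter_mem_eq_inter, Finset.univ_inter]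
          have hN0 : N ≠ 0 := hN.ne'
          field_simp
  -- assemble: `m₀W ≤ c²·(…) + a·(…)`, absorb the `W`-terms with `hκ`
  have hm₀eq : min (a / 2) (c ^ 2 * (P.L : ℝ) ^ (k * P.d) / (4 * ((P.L : ℝ) ^ k) ^ 2)) / (P.L : ℝ) ^ (k * P.d) = m₀ := by
    rw [hm₀, hNdef, hndef]
  rw [hm₀eq] at hmain
  have hfinal : m₀ * W ≤ (2 * P.d * c ^ 2 * (t / n) ^ 2 + a * N⁻¹ * t ^ 2) * E * W +
      E * ℓ⁻¹ ^ 2 * (2 * P.d * c ^ 2 + a * N⁻¹ * n ^ 2) * WS := by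
    have h := hmain.trans (add_le_add hD (mul_le_mul_of_nonneg_left hQ ha.le))
    have e : c ^ 2 * (2 * E * (ℓ⁻¹ ^ 2 * (P.d * WS) + (t / n) ^ 2 * (P.d * W))) + a * (N⁻¹ * E * (ℓ⁻¹ ^ 2 * n ^ 2 * WS + t ^ 2 * W)) =
        (2 * P.d * c ^ 2 * (t / n) ^ 2 + a * N⁻¹ * t ^ 2) * E * W + E * ℓ⁻¹ ^ 2 * (2 * P.d * c ^ 2 + a * N⁻¹ * n ^ 2) * WS := by ring
    linarith [h, e]
  have hW0 : 0 ≤ W := Finset.sum_nonneg fun x _ => by positivity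
  have hκ' : (2 * P.d * c ^ 2 * (t / n) ^ 2 + a * N⁻¹ * t ^ 2) * E * W ≤ m₀ / 2 * W := mul_le_mul_of_nonneg_right hκ hW0
  have : m₀ / 2 * W ≤ E * ℓ⁻¹ ^ 2 * (2 * P.d * c ^ 2 + a * N⁻¹ * n ^ 2) * WS := by linarith
  exact this

end

end Literature.MathematicalPhysics.QuantumFieldTheory.BalabanImbrieJaffe1984to88.BIJ85SmallFieldHarmonicAgmon
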